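import Literature.Analysis.FluidPDE.OnsagerBDSVDeformationBounds
import Literature.Analysis.FluidPDE.OnsagerBDSVEnergyCrossTerm
import Literature.Analysis.FluidPDE.OnsagerBDSVRhoQDeriv
import Literature.Analysis.FluidPDE.OnsagerBDSVDeformationTransportProofs
import Literature.Analysis.FluidPDE.OnsagerBDSVTildeRTransportProofs
import Literature.Analysis.FluidPDE.DeRosaPertDeformation
import Literature.Analysis.FluidPDE.DeRosaPerturbation
import HarnessLib

/-!
# De Rosa's perturbation stage: the transport of `∇Φᵢ` and `R̃_{q,i}` and `∂ₜρ_q` under the core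
# hypotheses — port of the BDSV transport bounds of Prop. 5.9

L. De Rosa, *Infinitely many Leray–Hopf solutions for the fractional Navier–Stokes equations*,
Comm. PDE 44 (2019) 335–365 = arXiv:1801.10235, §5.3 Lemma 5.9 (the bounds on `∂ₜρ_q`,
`∂ₜρ_{q,i}`) and §5.5 (the estimates "taken from [BDLSV2017]" = Buckmaster–De Lellis–Székelyhidi–
Vicol, CPAM 72 (2019), Prop. 5.9: `‖D_{t,q}∇Φᵢ‖_N ≲ δ_q^{1/2}λ_qℓ^{-N}`,
`‖D_{t,q}R̃_{q,i}‖_N ≲ τ_q⁻¹ℓ^{-N}`). The one place where the structure of the equations enters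
these BDSV proofs is `∂ₜρ_q` (BDSV Lemma 5.4 (5.18), from the energy balance of the Euler–Reynolds
system); De Rosa re-proves the same bound from the energy balance of (NSR) + Cor. 7.2 (proof of
Lemma 5.9, p. 15). In the tree this is the field `DeRosa.CoreHypotheses.energy_rate`
(`DeRosaPerturbation.lean`; derived for the NSR inputs in `DeRosaPertEnergyRate.lean`), and this
file re-runs the tree's BDSV proofs (`OnsagerBDSVRhoQDeriv`, `OnsagerBDSVDeformationTransportProofs`,
`OnsagerBDSVTildeRTransportProofs`, the two transport facts of `OnsagerBDSVDeformationBounds`)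
under `DeRosa.CoreHypotheses`, VERBATIM except for `∂ₜρ_q`:

* `DeRosa.rhoQDeriv S t = ⅓(e' - d/dt∫|v̄_q|²)` (for the core hypotheses the energy rate is only
  bounded, not given by a formula), `CoreHypotheses.hasDerivWithinAt_rhoQ`, `derivWithin_rhoQ`,
  and `CoreHypotheses.abs_rhoQDeriv_le` (`|ρ_q'| ≤ ⅓(1 + 6(C_inδ_{q+1}ℓ^α)(C_inδ_q^{1/2}λ_q))` from
  `energy_rate` and `|e'| ≤ 1`) — same statements as the BDSV twins, new two-line proofs; the
  reciprocal `ρ_q⁻¹` verbatim;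
* `DeRosa.gradPhiTransportBound`, `DeRosa.tildeRTransportBound` (BDSV Prop. 5.9 with
  `CoreHypotheses`), PROVED: `gradPhiTransportBound_holds`, `tildeRTransportBound_holds` (ports);
* the supporting H-dependent lemmas of those files (`exists_threshold_displacement_le`,
  `PerturbationData.advectiveDeriv_gradPhi`, `CoreHypotheses.gradedSupLE_*`, …).

## References

* L. De Rosa, Comm. PDE 44 (2019) 335–365 = arXiv:1801.10235, §5.3 Lemma 5.9 and its proof
  (p. 15), §5.5 Prop. 5.11. [`Derosa2018`]
* T. Buckmaster, C. De Lellis, L. Székelyhidi Jr., V. Vicol, CPAM 72 (2019) 229–274 =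
  arXiv:1701.08678, Lemma 5.4 (5.18), Prop. 5.9. [`BuckmasterEtAl2018`]
-/

open MeasureTheory Set
open scoped NNReal ENNReal ContDiff Matrix Matrix.Norms.Elementwise
open scoped NNReal ENNReal ContDiff InnerProductSpace Matrix Matrix.Norms.Elementwise
open scoped NNReal ENNReal ContDiff Matrix Matrix.Norms.Elementwise InnerProductSpace

noncomputable section

namespace Literature.Analysis.FluidPDE

/-! ## Port of `OnsagerBDSVDeformationBounds` -/

namespace DeRosa

open BDSV

open FunctionSpaces FunctionSpaces.Torus

/-- The flat three-torus `T³ = (ℝ/ℤ)³`, local notation. -/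
local notation "𝕋³" => UnitAddTorus (Fin 3)

/-- Euclidean `ℝ³`, local notation. -/
local notation "ℝ³" => EuclideanSpace ℝ (Fin 3)

/-- Real `3 × 3` matrices, local notation. -/
local notation "𝕄" => Matrix (Fin 3) (Fin 3) ℝ

section Intervals

end Intervals

section Facts

/-- **Material derivative of the deformation** (BDSV Prop. 5.9, first item, arXiv (5.37): "For
`t ∈ Ĩ_i` and `N ≥ 0` we have `‖D_{t,q} ∇Φ_i‖_N ≲ δ_q^{1/2} λ_q ℓ^{-N}`", `D_{t,q} = ∂ₜ + v̄_q·∇`;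
proof: `D_{t,q}∇Φ_i = -∇Φ_i Dv̄_q`, (2.19) and (5.23)). Transcription (module docstring): with
`D_{t,q} = BDSV.advectiveDeriv S.T S.vbar` (one-sided time derivative within `[0,T]`) applied to
the matrix field `∇Φ_i = BDSV.gradPhi 𝒟.D i`. [cite: BuckmasterEtAl2018, Prop. 5.9 (arXiv (5.37))] -/
def gradPhiTransportBound : Prop :=
  ∀ (c₀ : ℝ), 0 < c₀ → ∀ Cη : ℕ → ℕ → ℝ,
    ∀ β : ℝ, 0 < β → β < 1 / 3 → ∀ b : ℝ, 1 < b → b < (1 - β) / (2 * β) →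
      ∃ α₀ : ℝ, 0 < α₀ ∧ ∀ α : ℝ, 0 < α → α < α₀ → ∀ N : ℕ, ∃ Nbar : ℕ, ∀ Cin C₀ : ℝ,
        ∃ C a₀ : ℝ, 1 < a₀ ∧ ∀ a : ℝ, a₀ ≤ a → ∀ S : Setting,
          CoreHypotheses ⟨β, α, a, b⟩ S Nbar Cin C₀ →
            ∀ (𝒟 : PerturbationData ⟨β, α, a, b⟩ S c₀ Cη) (i : ℕ),
              HolderSupOnLE (tildeInterval S.T (Params.τ ⟨β, α, a, b⟩ S.q) i)
                (advectiveDeriv S.T S.vbar fun t x => gradPhi 𝒟.D i t x) N 0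
                (C * (Real.sqrt (amp β a b S.q) * freq a b S.q * mollScale β α a b S.q ^ (-(N : ℝ))))

/-- **Material derivative of the conjugated stress** (BDSV Prop. 5.9, second item, arXiv (5.38):
"`‖D_{t,q} R̃_{q,i}‖_N ≲ τ_q^{-1} ℓ^{-N}`" for `t ∈ Ĩ_i`, `N ≥ 0`; proof: arXiv (5.40)–(5.42),
differentiating (5.27) along the flow, with (2.20)–(2.21), Lemma 5.4, (5.23) and (5.37)).
Transcription as in `BDSV.gradPhiTransportBound`, for `R̃_{q,i} = BDSV.tildeR`, with
`τ_q = BDSV.Params.τ` (`BDSV.glueScale`). [cite: BuckmasterEtAl2018, Prop. 5.9 (arXiv (5.38))] -/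
def tildeRTransportBound : Prop :=
  ∀ (c₀ : ℝ), 0 < c₀ → ∀ Cη : ℕ → ℕ → ℝ,
    ∀ β : ℝ, 0 < β → β < 1 / 3 → ∀ b : ℝ, 1 < b → b < (1 - β) / (2 * β) →
      ∃ α₀ : ℝ, 0 < α₀ ∧ ∀ α : ℝ, 0 < α → α < α₀ → ∀ N : ℕ, ∃ Nbar : ℕ, ∀ Cin C₀ : ℝ,
        ∃ C a₀ : ℝ, 1 < a₀ ∧ ∀ a : ℝ, a₀ ≤ a → ∀ S : Setting,
          CoreHypotheses ⟨β, α, a, b⟩ S Nbar Cin C₀ →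
            ∀ (𝒟 : PerturbationData ⟨β, α, a, b⟩ S c₀ Cη) (i : ℕ),
              HolderSupOnLE (tildeInterval S.T (Params.τ ⟨β, α, a, b⟩ S.q) i)
                (advectiveDeriv S.T S.vbar (tildeR ⟨β, α, a, b⟩ S 𝒟.cut.η 𝒟.D i)) N 0
                (C * ((Params.τ ⟨β, α, a, b⟩ S.q)⁻¹ * mollScale β α a b S.q ^ (-(N : ℝ))))

end Facts

end DeRosa

/-! ## Port of `OnsagerBDSVDeformationTransportProofs` -/

namespace DeRosa

open BDSV

open FunctionSpaces FunctionSpaces.Torus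

section Displacement

/-- **The backward-flow displacements on `Ĩ_i` (BDSV Prop. 5.7, arXiv (5.23), displacement
form).** For `0 ≤ β`, `1 ≤ b`, `0 < α`, a constant `C_in` and a number of levels `N` there is
`a₀ > 1` such that for `a ≥ a₀`, every setting satisfying the standing hypotheses with
`N̄ ≥ N`, any construction data, any `i` and `t ∈ Ĩ_i`: `‖D_i(t)‖_{n+1,0} ≤ ℓ_q^{-n}` for all
`n ≤ N` (`Φ_i = id + D_i`; in particular `‖∇Φ_i - Id‖_n ≤ ℓ^{-n}`). Proof as in the source
("`‖∇Φ_i‖_N ≲ 1 + τ_q‖Dv̄_q‖_N ≲ 1 + τ_q δ_q^{1/2} λ_q ℓ^{-N}`" by (2.19) and (B.6) on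
`|t - t_i| ≲ τ_q`): `BDSV.displacement_allOrders` on `[max(0,t_i-τ_q/3), min(T,t_{i+1}+τ_q/3)]`
with `Λ = |C_in| δ_q^{1/2} λ_q`, `M = ℓ^{-1}`, and `(5/3) K |C_in| ℓ^{2α} ≤ 1` for `a ≥ a₀`
(`τ_q δ_q^{1/2} λ_q = ℓ^{2α}`). [cite: BuckmasterEtAl2018, Prop. 5.7 (arXiv (5.23)), proof] -/
theorem exists_threshold_displacement_le {β b α : ℝ} (hβ : 0 ≤ β) (hb : 1 ≤ b) (hα : 0 < α)
    (Cin : ℝ) (N : ℕ) :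
    ∃ a₀ : ℝ, 1 < a₀ ∧ ∀ {a : ℝ}, a₀ ≤ a →
      ∀ {S : Setting} {Nbar : ℕ} {C₀ c₀ : ℝ} {Cη : ℕ → ℕ → ℝ},
      CoreHypotheses ⟨β, α, a, b⟩ S Nbar Cin C₀ → N ≤ Nbar →
      ∀ (𝒟 : PerturbationData ⟨β, α, a, b⟩ S c₀ Cη) (i : ℕ),
      ∀ t ∈ tildeInterval S.T (Params.τ ⟨β, α, a, b⟩ S.q) i, ∀ n ≤ N,
        Torus.eContDiffHolderNorm (n + 1) 0 (𝒟.D i t) ≤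
          ENNReal.ofReal ((mollScale β α a b S.q)⁻¹ ^ n) := by
  obtain ⟨K, hK2, hK⟩ := displacement_allOrders (d := Fin 3) N
  have hK0 : 0 ≤ K := zero_le_two.trans hK2
  obtain ⟨a₀, ha₀1, ha₀⟩ :=
    exists_threshold_mollScale_rpow_le hβ hb hα (5 / 3 * K * |Cin|) one_pos
  refine ⟨a₀, ha₀1, ?_⟩
  intro a ha S Nbar C₀ c₀ Cη H hN 𝒟 i t ht n hn
  have ha1 : 1 ≤ a := ha₀1.le.trans ha
  have hℓ : 0 < mollScale β α a b S.q := mollScale_pos ha1 _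
  have hℓ1 : mollScale β α a b S.q ≤ 1 := mollScale_le_one_of_params ha1 hb hβ hα.le S.q
  have hτ : 0 < Params.τ ⟨β, α, a, b⟩ S.q := glueScale_pos ha1 _
  have hT : 0 < S.T := H.pos_T
  set ℓ := mollScale β α a b S.q with hℓdef
  set τ := Params.τ ⟨β, α, a, b⟩ S.q with hτdef
  set M := ℓ⁻¹ with hMdef
  have hM1 : 1 ≤ M := (one_le_inv₀ hℓ).2 hℓ1
  have hMk : ∀ k : ℕ, 1 ≤ M ^ k := fun k => one_le_pow₀ hM1
  have hMpow : ∀ n : ℕ, ℓ ^ (-(n : ℝ)) = M ^ n := fun n => by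
    rw [Real.rpow_neg hℓ.le, Real.rpow_natCast, hMdef, inv_pow]
  set Λ := |Cin| * (Real.sqrt (amp β a b S.q) * freq a b S.q) with hΛdef
  have hX0 : 0 ≤ Real.sqrt (amp β a b S.q) * freq a b S.q :=
    mul_nonneg (Real.sqrt_nonneg _) (freq_pos ha1 _).le
  have hΛ0 : 0 ≤ Λ := mul_nonneg (abs_nonneg _) hX0
  -- `Λ τ_q = |C_in| ℓ^{2α}` and the smallness for `a ≥ a₀`
  have hΛτ : Λ * τ = |Cin| * ℓ ^ (2 * α) :=
    velocityBound_mul_tau (P := ⟨β, α, a, b⟩) (Cin := |Cin|) ha1 S.q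
  have hsmall0 : 5 / 3 * K * |Cin| * ℓ ^ (2 * α) ≤ 1 := ha₀ a ha S.q
  -- (2.19) in the form `‖v̄_q(s)‖_{j+1} ≤ Λ M^j`, `j ≤ N`
  have hvb : ∀ s ∈ Icc 0 S.T, ∀ j ≤ N,
      Torus.eContDiffHolderNorm (j + 1) 0 (S.vbar s) ≤ ENNReal.ofReal (Λ * M ^ j) := by
    intro s hs j hj
    refine (H.velocity j (hj.trans hN) s hs).trans (ENNReal.ofReal_le_ofReal ?_)
    change Cin * (Real.sqrt (amp β a b S.q) * freq a b S.q * ℓ ^ (-(j : ℝ))) ≤ Λ * M ^ j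
    rw [hMpow j, hΛdef]
    calc Cin * (Real.sqrt (amp β a b S.q) * freq a b S.q * M ^ j)
        ≤ |Cin| * (Real.sqrt (amp β a b S.q) * freq a b S.q * M ^ j) :=
          mul_le_mul_of_nonneg_right (le_abs_self Cin) (mul_nonneg hX0 (zero_le_one.trans (hMk j)))
      _ = _ := by ring
  -- the transport equation of `D_i` on `[0,T]`
  have heq0 : ∀ s ∈ Icc 0 S.T, ∀ x, Torus.timeDerivWithin (Icc 0 S.T) (𝒟.D i) s x +
      Torus.convect (S.vbar s) (𝒟.D i s) x = -S.vbar s x :=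
    fun s hs x => eq_neg_of_add_eq_zero_left ((𝒟.flow i).transport s hs x)
  have hDsm : Torus.IsSmoothSpaceTimeOn (Icc 0 S.T) (𝒟.D i) := (𝒟.flow i).smooth
  have hvsm : Torus.IsSmoothSpaceTimeOn (Icc 0 S.T) S.vbar := H.eulerReynolds.smooth_velocity
  -- the interval `[a', b'] ⊇ Ĩ_i`
  obtain ⟨ht0, ht1⟩ := ht
  set a' := max 0 ((i : ℝ) * τ - τ / 3) with ha'def
  set b' := min S.T (((i : ℝ) + 1) * τ + τ / 3) with hb'def
  have hi0 : 0 ≤ (i : ℝ) * τ := mul_nonneg i.cast_nonneg hτ.le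
  have hab' : a' < b' := by
    refine max_lt (lt_min hT (by linarith [ht1.2, ht0.1])) (lt_min (by linarith [ht1.1, ht0.2]) ?_)
    nlinarith
  have hsub : Icc a' b' ⊆ Icc 0 S.T := fun s hs =>
    ⟨(le_max_left _ _).trans hs.1, hs.2.trans (min_le_left _ _)⟩
  have ht' : t ∈ Icc a' b' := ⟨max_le ht0.1 ht1.1.le, le_min ht0.2 ht1.2.le⟩
  have ht₀ : min ((i : ℝ) * τ) S.T ∈ Icc a' b' := by
    refine ⟨max_le (le_min hi0 hT.le) (le_min (by linarith) (by linarith [ht1.1, ht0.2])),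
      le_min (min_le_right _ _) ((min_le_left _ _).trans (by nlinarith))⟩
  have hlen : b' - a' ≤ 5 / 3 * τ := by
    have h1 : b' ≤ ((i : ℝ) + 1) * τ + τ / 3 := min_le_right _ _
    have h2 : (i : ℝ) * τ - τ / 3 ≤ a' := le_max_right _ _
    nlinarith
  -- smallness on `[a', b']`
  have hsmall : (b' - a') * Λ * K ≤ 1 := by
    calc (b' - a') * Λ * K ≤ (5 / 3 * τ) * Λ * K :=
          mul_le_mul_of_nonneg_right (mul_le_mul_of_nonneg_right hlen hΛ0) hK0
      _ = 5 / 3 * K * (Λ * τ) := by ring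
      _ = 5 / 3 * K * |Cin| * ℓ ^ (2 * α) := by rw [hΛτ]; ring
      _ ≤ 1 := hsmall0
  have hKLΛ : K * ((b' - a') * Λ) ≤ 1 := by
    calc K * ((b' - a') * Λ) = (b' - a') * Λ * K := by ring
      _ ≤ 1 := hsmall
  -- the all-orders bound for `D_i` on `[a', b']`
  have heq' := transport_restrict hab' hsub hDsm heq0
  have h := hK hab' (hvsm.mono hsub) (hDsm.mono hsub) heq' ht₀ (𝒟.flow i).anchor hΛ0 hM1
    (fun s hs j hj => hvb s (hsub hs) j hj) hsmall t ht' n hn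
  refine h.trans (ENNReal.ofReal_le_ofReal ?_)
  calc K * ((b' - a') * Λ) * M ^ n ≤ 1 * M ^ n :=
        mul_le_mul_of_nonneg_right hKLΛ (zero_le_one.trans (hMk n))
    _ = M ^ n := one_mul _

end Displacement

section Identity

variable {P : Params} {S : Setting} {Nbar : ℕ} {Cin C₀ c₀ : ℝ} {Cη : ℕ → ℕ → ℝ}

/-- **`D_{t,q}∇Φ_i = -∇Φ_i Dv̄_q`** (BDSV, proof of Prop. 5.9, first display): for the
construction data of the perturbation step under the standing hypotheses, the material
derivative `∂ₜ + v̄_q·∇` (one-sided in time within `[0,T]`) of the deformation matrix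
`∇Φ_i = Id + ∇D_i` (`BDSV.gradPhi`) of the `i`-th backward flow equals `-∇Φ_i · Dv̄_q` on
`[0,T] × T³`, where `(Dv̄_q)_{cb} = ∂_b (v̄_q)_c`. (Differentiate the transport equation
`(∂ₜ + v̄·∇)Φ_i = 0` in space: the tree's `BDSV.advectiveDeriv_gradField_eq`, read entrywise.)
[cite: BuckmasterEtAl2018, Prop. 5.9 (proof, first display)] -/
theorem PerturbationData.advectiveDeriv_gradPhi (H : CoreHypotheses P S Nbar Cin C₀)
    (𝒟 : PerturbationData P S c₀ Cη) (i : ℕ) {t : ℝ} (ht : t ∈ Icc 0 S.T) (x : UnitAddTorus (Fin 3)) :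
    advectiveDeriv S.T S.vbar (fun s y => gradPhi 𝒟.D i s y) t x =
      -(gradPhi 𝒟.D i t x * Matrix.of fun c b => Torus.partialDeriv b (S.vbar t) x c) := by
  have hT := H.pos_T
  have hv := H.eulerReynolds.smooth_velocity
  have hD : Torus.IsSmoothSpaceTimeOn (Icc 0 S.T) (𝒟.D i) := (𝒟.flow i).smooth
  have hGfield := hD.gradField (uniqueDiffOn_Icc hT)
  -- the entries `E` of `∇D_i`, `Jf` of `Id + ∇D_i`, and the velocity gradient `W`
  set E : ℝ → UnitAddTorus (Fin 3) → (Fin 3 → Fin 3 → ℝ) := fun s y a b =>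
    (gradField (𝒟.D i) s y (EuclideanSpace.single b 1)) a with hE
  set Jf : ℝ → UnitAddTorus (Fin 3) → (Fin 3 → Fin 3 → ℝ) := fun s y a b =>
    (if a = b then (1 : ℝ) else 0) + (gradField (𝒟.D i) s y (EuclideanSpace.single b 1)) a with hJf
  set W : Matrix (Fin 3) (Fin 3) ℝ :=
    Matrix.of fun a b => (gradField S.vbar t x (EuclideanSpace.single b 1)) a with hW
  have hJsm : Torus.IsSmoothSpaceTimeOn (Icc 0 S.T) Jf := isSmoothSpaceTimeOn_jacobianEntries hT hD
  have hofJ : ∀ s y, Matrix.of (Jf s y) = (1 : Matrix (Fin 3) (Fin 3) ℝ) + Matrix.of (E s y) :=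
    fun s y => of_jacobianEntries s y
  -- (1) `∇Φ_i = of Jf` on `[0,T]`, and `W` through partial derivatives
  have h1 : ∀ s ∈ Icc 0 S.T, ∀ y, gradPhi 𝒟.D i s y = Matrix.of (Jf s y) := by
    intro s hs y
    have hc : IsContDiff 1 (𝒟.D i s) := (hD.isSmooth_slice hs).isContDiff (by simp)
    ext a b
    simp only [gradPhi, Matrix.add_apply, Matrix.one_apply, Matrix.of_apply, hJf, gradField_apply,
      partialDeriv_eq_fderiv_apply hc]
  have hWeq : W = Matrix.of fun c b => Torus.partialDeriv b (S.vbar t) x c := by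
    have hc : IsContDiff 1 (S.vbar t) := (hv.isSmooth_slice ht).isContDiff (by simp)
    ext c b
    simp only [hW, Matrix.of_apply, gradField_apply, partialDeriv_eq_fderiv_apply hc]
  -- (2) replace the field inside the material derivative (only its values on `[0,T]` matter)
  have h2 : advectiveDeriv S.T S.vbar (fun s y => gradPhi 𝒟.D i s y) t x =
      advectiveDeriv S.T S.vbar (fun s y => Matrix.of (Jf s y)) t x := by
    rw [advectiveDeriv_apply, advectiveDeriv_apply]
    have e : (fun y => gradPhi 𝒟.D i t y) = fun y => Matrix.of (Jf t y) := funext (h1 t ht)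
    congr 1
    · unfold Torus.timeDerivWithin
      exact derivWithin_congr (fun s hs => h1 s hs x) (h1 t ht x)
    · show Torus.fderiv (fun y => gradPhi 𝒟.D i t y) x (S.vbar t x) =
        Torus.fderiv (fun y => Matrix.of (Jf t y)) x (S.vbar t x)
      rw [e]
  -- (3) the matrix-valued field and the field of its entries have the same material derivative
  have h3 : advectiveDeriv S.T S.vbar (fun s y => Matrix.of (Jf s y)) t x =
      Matrix.of (advectiveDeriv S.T S.vbar Jf t x) := rfl
  -- (4) entrywise: `(∂ₜ + v̄·∇)(Id + ∇D_i) = -(Id + ∇D_i) W`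
  have hadv := advectiveDeriv_gradField_eq hT hv hD (fun s hs y => (𝒟.flow i).advectiveDeriv_eq hs y)
    ht x
  have h4 : Matrix.of (advectiveDeriv S.T S.vbar Jf t x) = -(Matrix.of (Jf t x) * W) := by
    rw [hofJ, Matrix.add_mul, Matrix.one_mul]
    ext a b
    set L : (EuclideanSpace ℝ (Fin 3) →L[ℝ] EuclideanSpace ℝ (Fin 3)) →L[ℝ] ℝ :=
      (EuclideanSpace.proj a).comp
        (ContinuousLinearMap.apply ℝ (EuclideanSpace ℝ (Fin 3)) (EuclideanSpace.single b 1)) with hL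
    have hLapp : ∀ φ : EuclideanSpace ℝ (Fin 3) →L[ℝ] EuclideanSpace ℝ (Fin 3),
        L φ = (φ (EuclideanSpace.single b 1)) a := fun φ => rfl
    have e1 : advectiveDeriv S.T S.vbar Jf t x a b =
        advectiveDeriv S.T S.vbar (fun s y => Jf s y a b) t x := by
      have h := advectiveDeriv_clm_apply (v := S.vbar) hT hJsm (matrixEntry a b) ht x
      simpa only [matrixEntry_apply] using h.symm
    have e2 : (fun s y => Jf s y a b) =
        fun s y => (if a = b then (1 : ℝ) else 0) + L (gradField (𝒟.D i) s y) := by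
      funext s y
      simp only [hJf, hLapp]
    rw [Matrix.of_apply, e1, e2, advectiveDeriv_const_add,
      advectiveDeriv_clm_apply (v := S.vbar) hT hGfield L ht x, hadv, hLapp, Matrix.neg_apply,
      Matrix.add_apply, Matrix.mul_apply]
    change -(gradField S.vbar t x (EuclideanSpace.single b 1)) a -
        (gradField (𝒟.D i) t x (gradField S.vbar t x (EuclideanSpace.single b 1))) a = _
    rw [gradField_apply_coord (D := 𝒟.D i) t x (gradField S.vbar t x (EuclideanSpace.single b 1)) a]
    simp only [hE, hW, Matrix.of_apply, Fin.sum_univ_three]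
    ring
  rw [h2, h3, h4, ← h1 t ht x, hWeq]

end Identity

section Main

variable {d : Type} [Fintype d]

/-- **BDSV Prop. 5.9, first item (arXiv (5.37)): `‖D_{t,q}∇Φ_i‖_N ≲ δ_q^{1/2} λ_q ℓ^{-N}` on
`Ĩ_i`** — the named fact `BDSV.gradPhiTransportBound` holds. Proof as printed:
`D_{t,q}∇Φ_i = -∇Φ_i Dv̄_q` (`BDSV.PerturbationData.advectiveDeriv_gradPhi`); the `C^{N,0}` norm
of the matrix field is bounded through its entries `∑_c (∇Φ_i)_{ac} ∂_b(v̄_q)_c` by the Leibniz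
estimate, with `‖(∇Φ_i)_{ac}‖_j ≤ 1 + ‖D_i‖_{j+1} ≤ 2ℓ^{-j}` ((5.23) in displacement form,
`BDSV.exists_threshold_displacement_le`) and `‖∂_b(v̄_q)_c‖_m ≤ ‖v̄_q‖_{m+1} ≤ |C_in| δ_q^{1/2}λ_q ℓ^{-m}`
((2.19)); constants `α₀ = 1`, `N̄ = N`, `C = 54 (N+1) 3ᴺ |C_in|`, `a₀ = a₀(β, b, α, C_in, N)`.
[cite: BuckmasterEtAl2018, Prop. 5.9 (arXiv (5.37))] -/
theorem gradPhiTransportBound_holds : gradPhiTransportBound := by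
  intro c₀ _ Cη β hβ _ b hb1 _
  refine ⟨1, one_pos, ?_⟩
  intro α hα _ N
  refine ⟨N, ?_⟩
  intro Cin C₀
  obtain ⟨a₀, ha₀1, hdisp⟩ := exists_threshold_displacement_le hβ.le hb1.le hα Cin N
  refine ⟨54 * ((N : ℝ) + 1) * 3 ^ N * |Cin|, a₀, ha₀1, ?_⟩
  intro a ha S H 𝒟 i t ht
  -- parameters
  have ha1 : 1 ≤ a := ha₀1.le.trans ha
  have hℓ : 0 < mollScale β α a b S.q := mollScale_pos ha1 _
  have hℓ1 : mollScale β α a b S.q ≤ 1 := mollScale_le_one_of_params ha1 hb1.le hβ.le hα.le S.q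
  set ℓ := mollScale β α a b S.q with hℓdef
  set M := ℓ⁻¹ with hMdef
  have hM1 : 1 ≤ M := (one_le_inv₀ hℓ).2 hℓ1
  have hM0 : 0 ≤ M := zero_le_one.trans hM1
  have hMk : ∀ k : ℕ, 1 ≤ M ^ k := fun k => one_le_pow₀ hM1
  have hMpow : ∀ n : ℕ, ℓ ^ (-(n : ℝ)) = M ^ n := fun n => by
    rw [Real.rpow_neg hℓ.le, Real.rpow_natCast, hMdef, inv_pow]
  set Λ := |Cin| * (Real.sqrt (amp β a b S.q) * freq a b S.q) with hΛdef
  have hX0 : 0 ≤ Real.sqrt (amp β a b S.q) * freq a b S.q :=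
    mul_nonneg (Real.sqrt_nonneg _) (freq_pos ha1 _).le
  have hΛ0 : 0 ≤ Λ := mul_nonneg (abs_nonneg _) hX0
  have ht' : t ∈ Icc 0 S.T := tildeInterval_subset_Icc _ _ _ ht
  have hDt : IsSmooth (𝒟.D i t) := (𝒟.flow i).smooth.isSmooth_slice ht'
  have hvs : IsSmooth (S.vbar t) := H.eulerReynolds.smooth_velocity.isSmooth_slice ht'
  -- (5.23), displacement form, and (2.19)
  have hDb : ∀ n ≤ N, Torus.eContDiffHolderNorm (n + 1) 0 (𝒟.D i t) ≤ ENNReal.ofReal (M ^ n) :=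
    fun n hn => hdisp ha H le_rfl 𝒟 i t ht n hn
  -- level-wise bounds for the entries of `∇Φ_i(t)` and of `Dv̄_q(t)`
  have hAe : ∀ k₁ k₃ : Fin 3, IsContDiff N (fun x => gradPhi 𝒟.D i t x k₁ k₃) := fun k₁ k₃ =>
    (isSmooth_gradPhi_entry hDt k₁ k₃).isContDiff (by exact_mod_cast le_top)
  have hBe : ∀ k₃ k₂ : Fin 3, IsContDiff N (fun x => Torus.partialDeriv k₂ (S.vbar t) x k₃) :=
    fun k₃ k₂ => ((hvs.partialDeriv k₂).apply k₃).isContDiff (by exact_mod_cast le_top)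
  have hAE : ∀ j ≤ N, ∀ k₁ k₃ : Fin 3,
      Torus.eContDiffHolderNorm j 0 (fun x => gradPhi 𝒟.D i t x k₁ k₃) ≤ ENNReal.ofReal (2 * M ^ j) := by
    intro j hj k₁ k₃
    have e : (fun x => gradPhi 𝒟.D i t x k₁ k₃) =
        fun x => (1 : Matrix (Fin 3) (Fin 3) ℝ) k₁ k₃ + Torus.partialDeriv k₃ (𝒟.D i t) x k₁ := by
      funext x; exact gradPhi_apply 𝒟.D i t x k₁ k₃
    rw [e]
    refine (eContDiffHolderNorm_const_add_partialDeriv_le hDt _ k₁ k₃ j 0).trans ?_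
    have h1 : ‖(1 : Matrix (Fin 3) (Fin 3) ℝ) k₁ k₃‖ₑ ≤ ENNReal.ofReal (M ^ j) := by
      rw [← ofReal_norm]
      refine ENNReal.ofReal_le_ofReal (le_trans ?_ (hMk j))
      rw [Matrix.one_apply]
      split_ifs <;> simp
    calc ‖(1 : Matrix (Fin 3) (Fin 3) ℝ) k₁ k₃‖ₑ + Torus.eContDiffHolderNorm (j + 1) 0 (𝒟.D i t)
        ≤ ENNReal.ofReal (M ^ j) + ENNReal.ofReal (M ^ j) := add_le_add h1 (hDb j hj)
      _ = ENNReal.ofReal (2 * M ^ j) := by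
          rw [two_mul, ENNReal.ofReal_add (by positivity) (by positivity)]
  have hBF : ∀ j ≤ N, ∀ k₃ k₂ : Fin 3,
      Torus.eContDiffHolderNorm j 0 (fun x => Torus.partialDeriv k₂ (S.vbar t) x k₃) ≤
        ENNReal.ofReal (Λ * M ^ j) := by
    intro j hj k₃ k₂
    have hpd : IsSmooth (Torus.partialDeriv k₂ (S.vbar t)) := hvs.partialDeriv k₂
    refine ((eContDiffHolderNorm_coord_le hpd j 0 k₃).trans
      (Torus.eContDiffHolderNorm_partialDeriv_le (hvs.isContDiff (by exact_mod_cast le_top)) k₂ 0)).trans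
      ?_
    refine (H.velocity j hj t ht').trans (ENNReal.ofReal_le_ofReal ?_)
    change Cin * (Real.sqrt (amp β a b S.q) * freq a b S.q * ℓ ^ (-(j : ℝ))) ≤ Λ * M ^ j
    rw [hMpow j, hΛdef]
    calc Cin * (Real.sqrt (amp β a b S.q) * freq a b S.q * M ^ j)
        ≤ |Cin| * (Real.sqrt (amp β a b S.q) * freq a b S.q * M ^ j) :=
          mul_le_mul_of_nonneg_right (le_abs_self Cin) (mul_nonneg hX0 (zero_le_one.trans (hMk j)))
      _ = _ := by ring
  -- the products `(∇Φ_i)_{ac} ∂_b(v̄_q)_c`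
  set q : ℝ := 3 ^ N * (((N : ℝ) + 1) * (2 * Λ * M ^ N)) with hqdef
  have hq0 : 0 ≤ q := by positivity
  have hprod : ∀ k₁ k₂ k₃ : Fin 3, Torus.eContDiffHolderNorm N 0
      (fun x => gradPhi 𝒟.D i t x k₁ k₃ * Torus.partialDeriv k₂ (S.vbar t) x k₃) ≤ ENNReal.ofReal q := by
    intro k₁ k₂ k₃
    refine (eContDiffHolderNorm_mul_le_of_levels₂ (hAe k₁ k₃) (hBe k₃ k₂) 0
      (E := fun j => 2 * M ^ j) (F := fun j => Λ * M ^ j) (fun j => by positivity)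
      (fun j => by positivity) (fun j hj => hAE j hj k₁ k₃) (fun j hj => hBF j hj k₃ k₂)).trans
      (ENNReal.ofReal_le_ofReal (le_of_eq ?_))
    have hterm : ∀ j ∈ Finset.range (N + 1), 2 * M ^ j * (Λ * M ^ (N - j)) = 2 * Λ * M ^ N := by
      intro j hj
      have hjN : j ≤ N := Nat.lt_succ_iff.1 (Finset.mem_range.1 hj)
      have hpow : M ^ j * M ^ (N - j) = M ^ N := by rw [← pow_add, Nat.add_sub_cancel' hjN]
      calc 2 * M ^ j * (Λ * M ^ (N - j)) = 2 * Λ * (M ^ j * M ^ (N - j)) := by ring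
        _ = 2 * Λ * M ^ N := by rw [hpow]
    rw [Finset.sum_congr rfl hterm, Finset.sum_const, Finset.card_range, nsmul_eq_mul, hqdef]
    push_cast
    ring
  -- the entries of `∇Φ_i Dv̄_q`
  set Wm : UnitAddTorus (Fin 3) → Matrix (Fin 3) (Fin 3) ℝ :=
    fun x => Matrix.of fun c b' => Torus.partialDeriv b' (S.vbar t) x c with hWm
  have hent : ∀ k₁ k₂ : Fin 3,
      Torus.eContDiffHolderNorm N 0 (fun x => (gradPhi 𝒟.D i t x * Wm x) k₁ k₂) ≤
        ENNReal.ofReal (3 * q) := by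
    intro k₁ k₂
    have e : (fun x => (gradPhi 𝒟.D i t x * Wm x) k₁ k₂) =
        ∑ k₃, fun x => gradPhi 𝒟.D i t x k₁ k₃ * Torus.partialDeriv k₂ (S.vbar t) x k₃ := by
      funext x
      simp only [Finset.sum_apply, Matrix.mul_apply, hWm, Matrix.of_apply]
    rw [e, ← sum_fin_three_ofReal_const q]
    refine (Torus.eContDiffHolderNorm_sum_le Finset.univ fun k₃ _ => ?_).trans
      (Finset.sum_le_sum fun k₃ _ => hprod k₁ k₂ k₃)
    exact (hAe k₁ k₃).mul (hBe k₃ k₂)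
  -- the matrix field `∇Φ_i Dv̄_q` is `C^N`
  have hAB : IsContDiff N (fun x => gradPhi 𝒟.D i t x * Wm x) := by
    refine contDiff_pi.2 fun k₁ => contDiff_pi.2 fun k₂ => ?_
    have e : (fun y => lift (fun x => gradPhi 𝒟.D i t x * Wm x) y k₁ k₂) =
        fun y => ∑ k₃, lift (fun x => gradPhi 𝒟.D i t x k₁ k₃) y *
          lift (fun x => Torus.partialDeriv k₂ (S.vbar t) x k₃) y := by
      funext y
      simp only [lift_apply, Matrix.mul_apply, hWm, Matrix.of_apply]
    rw [e]
    exact ContDiff.sum fun k₃ _ => (hAe k₁ k₃).mul (hBe k₃ k₂)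
  -- assemble
  have hslice : advectiveDeriv S.T S.vbar (fun s y => gradPhi 𝒟.D i s y) t =
      -(fun x => gradPhi 𝒟.D i t x * Wm x) :=
    funext fun x => 𝒟.advectiveDeriv_gradPhi H i ht' x
  show Torus.eContDiffHolderNorm N 0 (advectiveDeriv S.T S.vbar (fun s y => gradPhi 𝒟.D i s y) t) ≤
    ENNReal.ofReal (54 * ((N : ℝ) + 1) * 3 ^ N * |Cin| *
      (Real.sqrt (amp β a b S.q) * freq a b S.q * ℓ ^ (-(N : ℝ))))
  rw [hslice, Torus.eContDiffHolderNorm_neg]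
  refine (eContDiffHolderNorm_matrix_le_sum hAB 0).trans ?_
  calc ∑ k₁, ∑ k₂, Torus.eContDiffHolderNorm N 0 (fun x => (gradPhi 𝒟.D i t x * Wm x) k₁ k₂)
      ≤ ∑ _k₁ : Fin 3, ∑ _k₂ : Fin 3, ENNReal.ofReal (3 * q) :=
        Finset.sum_le_sum fun k₁ _ => Finset.sum_le_sum fun k₂ _ => hent k₁ k₂
    _ = ENNReal.ofReal (3 * (3 * (3 * q))) := by
        rw [sum_fin_three_ofReal_const, sum_fin_three_ofReal_const]
    _ = ENNReal.ofReal (54 * ((N : ℝ) + 1) * 3 ^ N * |Cin| *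
          (Real.sqrt (amp β a b S.q) * freq a b S.q * ℓ ^ (-(N : ℝ)))) := by
        rw [hMpow N, hqdef, hΛdef]
        ring_nf

end Main

end DeRosa

/-! ## Port of `OnsagerBDSVEnergyCrossTerm` -/

namespace DeRosa

open BDSV

open FunctionSpaces FunctionSpaces.Torus

section Mono

variable {P : Params} {S : Setting} {Nbar : ℕ} {Cin Cin' C₀ : ℝ}

/-- The standing hypotheses with input constant `C_in` imply those with any larger constant (all
the scales multiplying `C_in` in (2.19)–(2.21) are nonnegative for `a ≥ 1`). [folklore] -/
theorem CoreHypotheses.mono_const (H : CoreHypotheses P S Nbar Cin C₀)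
    (ha : 1 ≤ P.a) (h : Cin ≤ Cin') : CoreHypotheses P S Nbar Cin' C₀ where
  pos_T := H.pos_T
  profile := H.profile
  eulerReynolds := H.eulerReynolds
  stress_support := H.stress_support
  velocity_sup := H.velocity_sup
  velocity N hN := (H.velocity N hN).mono (mul_le_mul_of_nonneg_right h
    (mul_nonneg (mul_nonneg (Real.sqrt_nonneg _) (freq_pos ha _).le)
      (Real.rpow_nonneg (mollScale_pos ha _).le _)))
  stress N hN := (H.stress N hN).mono (mul_le_mul_of_nonneg_right h
    (mul_nonneg (amp_pos ha _).le (Real.rpow_nonneg (mollScale_pos ha _).le _)))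
  transport N hN := (H.transport N hN).mono (mul_le_mul_of_nonneg_right h
    (mul_nonneg (mul_nonneg (mul_nonneg (amp_pos ha _).le (Real.sqrt_nonneg _))
      (freq_pos ha _).le) (Real.rpow_nonneg (mollScale_pos ha _).le _)))
  energy_gap := H.energy_gap
  energy_rate t ht := by
    -- the scales are nonnegative
    have hX : 0 ≤ amp P.β P.a P.b (S.q + 1) * mollScale P.β P.α P.a P.b S.q ^ P.α :=
      mul_nonneg (amp_pos ha _).le (Real.rpow_nonneg (mollScale_pos ha _).le _)
    have hY : 0 ≤ Real.sqrt (amp P.β P.a P.b S.q) * freq P.a P.b S.q :=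
      mul_nonneg (Real.sqrt_nonneg _) (freq_pos ha _).le
    have hRHS : ∀ c : ℝ, 6 * (c * (amp P.β P.a P.b (S.q + 1) * mollScale P.β P.α P.a P.b S.q ^ P.α)) *
        (c * (Real.sqrt (amp P.β P.a P.b S.q) * freq P.a P.b S.q)) =
          6 * c ^ 2 * ((amp P.β P.a P.b (S.q + 1) * mollScale P.β P.α P.a P.b S.q ^ P.α) *
            (Real.sqrt (amp P.β P.a P.b S.q) * freq P.a P.b S.q)) := fun c => by ring
    by_cases hc : 0 ≤ Cin
    · -- `C_in² ≤ C_in'²`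
      refine (H.energy_rate t ht).trans ?_
      rw [hRHS, hRHS]
      exact mul_le_mul_of_nonneg_right (mul_le_mul_of_nonneg_left (pow_le_pow_left₀ hc h 2)
        (by norm_num)) (mul_nonneg hX hY)
    · -- a negative input constant forces `v̄_q ≡ 0` on `[0,T]`, so the energy is constant
      push Not at hc
      have hzero : ∀ s ∈ Icc 0 S.T, ∀ x, S.vbar s x = 0 := by
        intro s hs x
        have hv := H.velocity 0 (Nat.zero_le _) s hs
        have hneg : Cin * (Real.sqrt (amp P.β P.a P.b S.q) * freq P.a P.b S.q *
            mollScale P.β P.α P.a P.b S.q ^ (-((0 : ℕ) : ℝ))) ≤ 0 := by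
          simp only [Nat.cast_zero, neg_zero, Real.rpow_zero, mul_one]
          exact mul_nonpos_of_nonpos_of_nonneg hc.le hY
        rw [ENNReal.ofReal_of_nonpos hneg] at hv
        have h0 : ‖S.vbar s x‖ₑ = 0 := le_antisymm ((enorm_le_eSupNorm _ x).trans
          ((Torus.eSupNorm_le_eContDiffHolderNorm (0 + 1) 0 (S.vbar s)).trans hv)) bot_le
        simpa using h0
      have hconst : derivWithin (fun s => ∫ x, ‖S.vbar s x‖ ^ 2) (Icc 0 S.T) t = 0 := by
        have hEq : EqOn (fun s => ∫ x, ‖S.vbar s x‖ ^ 2) (fun _ => (0 : ℝ)) (Icc 0 S.T) :=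
          fun s hs => by simp [hzero s hs]
        rw [derivWithin_congr hEq (hEq ht)]
        simp
      rw [hconst, abs_zero, hRHS]
      exact mul_nonneg (mul_nonneg (by norm_num) (sq_nonneg _)) (mul_nonneg hX hY)

end Mono

section Pointwise

variable {P : Params} {S : Setting} {Nbar : ℕ} {Cin C₀ c₀ : ℝ} {Cη : ℕ → ℕ → ℝ}

end Pointwise

section Discharge

variable {P : Params} {S : Setting} {Nbar : ℕ} {Cin C₀ c₀ : ℝ} {Cη : ℕ → ℕ → ℝ}

end Discharge

end DeRosa

/-! ## Port of `OnsagerBDSVRhoQDeriv` -/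

namespace DeRosa

open BDSV

open FunctionSpaces FunctionSpaces.Torus

/-- The flat three-torus `T³ = (ℝ/ℤ)³`, local notation. -/
local notation "𝕋³" => UnitAddTorus (Fin 3)

/-- Euclidean `ℝ³`, local notation. -/
local notation "ℝ³" => EuclideanSpace ℝ (Fin 3)

/-- Real `3 × 3` matrices, local notation. -/
local notation "𝕄" => Matrix (Fin 3) (Fin 3) ℝ

variable {P : Params} {S : Setting} {Nbar : ℕ} {Cin C₀ c₀ : ℝ} {Cη : ℕ → ℕ → ℝ}

section EtaMass

/-- **The coefficient of (5.27) simplifies on `[0,T]`**: `(∑_j∫η_j²/ρ_q) R̊̄_q = ρ_q⁻¹ R̊̄_q`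
pointwise on `[0,T] × T³` (on `supp R̊̄_q ⊂ ⋃ₙ Iₙ × T³`, (2.17), the mass is `1`; elsewhere both
sides vanish). [cite: BuckmasterEtAl2018, Prop. 5.7 (proof, arXiv (5.27))] -/
theorem PerturbationData.etaMass_div_rhoQ_smul_Rbar (H : CoreHypotheses P S Nbar Cin C₀)
    (𝒟 : PerturbationData P S c₀ Cη) (ha : 1 ≤ P.a) {t : ℝ} (ht : t ∈ Icc 0 S.T) (x : 𝕋³) :
    (etaMass P S 𝒟.cut.η t / rhoQ P S t) • ofCols (S.Rbar t x) =
      (rhoQ P S t)⁻¹ • ofCols (S.Rbar t x) := by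
  by_cases h : ∃ n : ℕ, t ∈ Icc ((n : ℝ) * P.τ S.q + P.τ S.q / 3) ((n : ℝ) * P.τ S.q + 2 * P.τ S.q / 3)
  · obtain ⟨n, hn⟩ := h
    rw [𝒟.etaMass_eq_one ha ht hn, one_div]
  · push Not at h
    have hR : S.Rbar t x = 0 := H.stress_support t ht h x
    rw [hR, ofCols_zero, smul_zero, smul_zero]

/-- **`R̃_{q,i}` on `[0,T]`**: `R̃_{q,i} = ∇Φ_i (Id - ρ_q⁻¹ R̊̄_q) ∇Φ_iᵀ` for `t ∈ [0,T]` (the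
(5.32)/(5.27) form with the mass normalised to `1`). [cite: BuckmasterEtAl2018, Prop. 5.7 (proof, arXiv (5.27))] -/
theorem PerturbationData.tildeR_eq (H : CoreHypotheses P S Nbar Cin C₀)
    (𝒟 : PerturbationData P S c₀ Cη) (ha : 1 ≤ P.a) (i : ℕ) {t : ℝ} (ht : t ∈ Icc 0 S.T) (x : 𝕋³) :
    tildeR P S 𝒟.cut.η 𝒟.D i t x =
      gradPhi 𝒟.D i t x * (1 - (rhoQ P S t)⁻¹ • ofCols (S.Rbar t x)) * (gradPhi 𝒟.D i t x)ᵀ := by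
  rw [tildeR, 𝒟.etaMass_div_rhoQ_smul_Rbar H ha ht x]

end EtaMass

section RhoQ

/-- **The derivative of `ρ_q` within `[0,T]`, as a name**: `ρ_q' = ⅓(e' - d/dt∫|v̄_q|²)`
(one-sided derivatives within `[0,T]`). Under the core hypotheses the energy rate
`d/dt∫|v̄_q|²` is not given by a formula (for Euler–Reynolds it is `-2∫∑ⱼ⟪R̊̄_q^{(j)},∂ⱼv̄_q⟫`,
`BDSV.rhoQDeriv`; for (NSR) it has the extra dissipation) but only bounded
(`DeRosa.CoreHypotheses.energy_rate`), which is all the estimates use.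
[cite: Derosa2018, §5.3 Lemma 5.9 (the bound on ∂ₜρ_q)] -/
def rhoQDeriv (S : Setting) (t : ℝ) : ℝ :=
  (derivWithin S.e (Icc 0 S.T) t -
    derivWithin (fun s => ∫ x, ‖S.vbar s x‖ ^ 2) (Icc 0 S.T) t) / 3

/-- **`ρ_q` is differentiable within `[0,T]`** with `ρ_q' = ⅓(e' - d/dt∫|v̄_q|²)` (`e` is smooth on
`[0,T]` and space integrals of jointly smooth fields are differentiable in time).
[cite: Derosa2018, §5.3 Lemma 5.9 (the bound on ∂ₜρ_q)] -/
theorem CoreHypotheses.hasDerivWithinAt_rhoQ (H : CoreHypotheses P S Nbar Cin C₀)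
    {t : ℝ} (ht : t ∈ Icc 0 S.T) :
    HasDerivWithinAt (rhoQ P S) (rhoQDeriv S t) (Icc 0 S.T) t := by
  have he : HasDerivWithinAt S.e (derivWithin S.e (Icc 0 S.T) t) (Icc 0 S.T) t :=
    ((H.profile.smooth.differentiableOn (by simp)) t ht).hasDerivWithinAt
  have hv := H.eulerReynolds.smooth_velocity
  have hsq : Torus.IsSmoothSpaceTimeOn (Icc 0 S.T) (fun s x => ‖S.vbar s x‖ ^ 2) := by
    have h := hv.inner hv
    refine ContDiffOn.congr h ?_
    rintro ⟨s, y⟩ _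
    simp only [stLift_apply]
    exact (real_inner_self_eq_norm_sq _).symm
  have hE0 := hsq.hasDerivWithinAt_integral (convex_Icc 0 S.T) ht
  have hE : HasDerivWithinAt (fun s => ∫ x, ‖S.vbar s x‖ ^ 2)
      (derivWithin (fun s => ∫ x, ‖S.vbar s x‖ ^ 2) (Icc 0 S.T) t) (Icc 0 S.T) t := by
    rw [hE0.derivWithin (uniqueDiffOn_Icc H.pos_T t ht)]
    exact hE0
  have h := ((he.sub_const (amp P.β P.a P.b (S.q + 2) / 2)).sub hE).div_const 3
  have hfun : rhoQ P S = fun s =>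
      (S.e s - amp P.β P.a P.b (S.q + 2) / 2 - ∫ x, ‖S.vbar s x‖ ^ 2) / 3 := by
    funext s
    rfl
  rw [hfun]
  exact h

/-- `derivWithin ρ_q [0,T] = rhoQDeriv` on `[0,T]`. [folklore] -/
theorem CoreHypotheses.derivWithin_rhoQ (H : CoreHypotheses P S Nbar Cin C₀)
    {t : ℝ} (ht : t ∈ Icc 0 S.T) :
    derivWithin (rhoQ P S) (Icc 0 S.T) t = rhoQDeriv S t :=
  (H.hasDerivWithinAt_rhoQ ht).derivWithin (uniqueDiffOn_Icc H.pos_T t ht)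

/-- **De Rosa Lemma 5.9 / BDSV Lemma 5.4 (5.18), explicit form**:
`|ρ_q'| ≤ ⅓(1 + 6 (C_in δ_{q+1} ℓ^α)(C_in δ_q^{1/2} λ_q))` on `[0,T]`, from `|e'| ≤ 1` and the
energy-rate bound of the core hypotheses (the source then absorbs `1 ≲ δ_{q+1}δ_q^{1/2}λ_q`,
valid for `b < (1-β)/(2β)` and `a` large). The hypotheses `0 ≤ C_in`, `1 ≤ a` of the BDSV twin are
kept in the signature (unused here). [cite: Derosa2018, §5.3 Lemma 5.9 (the bound on ∂ₜρ_q)] -/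
theorem CoreHypotheses.abs_rhoQDeriv_le (H : CoreHypotheses P S Nbar Cin C₀)
    (_hCin : 0 ≤ Cin) (_ha : 1 ≤ P.a) {t : ℝ} (ht : t ∈ Icc 0 S.T) :
    |rhoQDeriv S t| ≤
      (1 + 6 * (Cin * (amp P.β P.a P.b (S.q + 1) * mollScale P.β P.α P.a P.b S.q ^ P.α)) *
        (Cin * (Real.sqrt (amp P.β P.a P.b S.q) * freq P.a P.b S.q))) / 3 := by
  have hrate := H.energy_rate t ht
  have he := H.profile.abs_deriv_le t ht
  unfold rhoQDeriv
  rw [abs_div, abs_of_pos (by norm_num : (0 : ℝ) < 3), div_le_div_iff_of_pos_right (by norm_num)]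
  calc |derivWithin S.e (Icc 0 S.T) t - derivWithin (fun s => ∫ x, ‖S.vbar s x‖ ^ 2) (Icc 0 S.T) t|
      ≤ |derivWithin S.e (Icc 0 S.T) t| + |derivWithin (fun s => ∫ x, ‖S.vbar s x‖ ^ 2) (Icc 0 S.T) t| :=
        abs_sub _ _
    _ ≤ 1 + 6 * (Cin * (amp P.β P.a P.b (S.q + 1) * mollScale P.β P.α P.a P.b S.q ^ P.α)) *
        (Cin * (Real.sqrt (amp P.β P.a P.b S.q) * freq P.a P.b S.q)) := add_le_add he hrate

/-- `ρ_q > 0` on `[0,T]` under the lower bound (5.15), i.e. given `4δ_{q+2} ≤ δ_{q+1}λ_q^{-α}`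
(a local variant of `CoreHypotheses.rhoQ_pos` of `OnsagerBDSVStressSplit.lean`, which assumes
`2δ_{q+2} ≤ δ_{q+1}λ_q^{-α}`; kept private to avoid that import). [cite: BuckmasterEtAl2018, Lemma 5.4 (arXiv (5.15))] -/
private theorem CoreHypotheses.rhoQ_pos_of_four (H : CoreHypotheses P S Nbar Cin C₀)
    (ha : 1 ≤ P.a)
    (h4 : 4 * amp P.β P.a P.b (S.q + 2) ≤ amp P.β P.a P.b (S.q + 1) * freq P.a P.b S.q ^ (-P.α))
    {t : ℝ} (ht : t ∈ Icc 0 S.T) : 0 < rhoQ P S t := by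
  have hpos : 0 < amp P.β P.a P.b (S.q + 1) * freq P.a P.b S.q ^ (-P.α) / 8 :=
    div_pos (mul_pos (amp_pos ha _) (Real.rpow_pos_of_pos (freq_pos ha _) _)) (by norm_num)
  exact hpos.trans_le (H.le_rhoQ h4 ht)

/-- `ρ_q⁻¹` is smooth on `[0,T]` (where `ρ_q > 0`). [folklore] -/
theorem CoreHypotheses.contDiffOn_inv_rhoQ (H : CoreHypotheses P S Nbar Cin C₀)
    (ha : 1 ≤ P.a)
    (h4 : 4 * amp P.β P.a P.b (S.q + 2) ≤ amp P.β P.a P.b (S.q + 1) * freq P.a P.b S.q ^ (-P.α)) :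
    ContDiffOn ℝ ∞ (fun t => (rhoQ P S t)⁻¹) (Icc 0 S.T) :=
  (contDiffOn_rhoQ H.pos_T H.profile.smooth H.eulerReynolds.smooth_velocity).inv
    fun _ ht => (H.rhoQ_pos_of_four ha h4 ht).ne'

/-- **`|ρ_q⁻¹| ≤ 8λ_q^α/δ_{q+1}`** on `[0,T]` (from (5.15)). [cite: BuckmasterEtAl2018, Lemma 5.4 (arXiv (5.15))] -/
theorem CoreHypotheses.abs_inv_rhoQ_le (H : CoreHypotheses P S Nbar Cin C₀)
    (ha : 1 ≤ P.a)
    (h4 : 4 * amp P.β P.a P.b (S.q + 2) ≤ amp P.β P.a P.b (S.q + 1) * freq P.a P.b S.q ^ (-P.α))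
    {t : ℝ} (ht : t ∈ Icc 0 S.T) :
    |(rhoQ P S t)⁻¹| ≤ 8 * freq P.a P.b S.q ^ P.α / amp P.β P.a P.b (S.q + 1) := by
  have hf := freq_pos (b := P.b) ha S.q
  have hA := amp_pos (β := P.β) (b := P.b) ha (S.q + 1)
  have hρ := H.rhoQ_pos_of_four ha h4 ht
  have hlow := H.le_rhoQ h4 ht
  rw [abs_of_pos (inv_pos.2 hρ), inv_le_comm₀ hρ (by positivity)]
  calc (8 * freq P.a P.b S.q ^ P.α / amp P.β P.a P.b (S.q + 1))⁻¹
      = amp P.β P.a P.b (S.q + 1) * freq P.a P.b S.q ^ (-P.α) / 8 := by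
        rw [Real.rpow_neg hf.le]
        field_simp
    _ ≤ rhoQ P S t := hlow

/-- **`ρ_q⁻¹` is differentiable within `[0,T]`** with derivative `-ρ_q'/ρ_q²`. [folklore] -/
theorem CoreHypotheses.hasDerivWithinAt_inv_rhoQ (H : CoreHypotheses P S Nbar Cin C₀)
    (ha : 1 ≤ P.a)
    (h4 : 4 * amp P.β P.a P.b (S.q + 2) ≤ amp P.β P.a P.b (S.q + 1) * freq P.a P.b S.q ^ (-P.α))
    {t : ℝ} (ht : t ∈ Icc 0 S.T) :
    HasDerivWithinAt (fun s => (rhoQ P S s)⁻¹) (-rhoQDeriv S t / rhoQ P S t ^ 2) (Icc 0 S.T) t :=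
  (H.hasDerivWithinAt_rhoQ ht).inv (H.rhoQ_pos_of_four ha h4 ht).ne'

/-- **`|(ρ_q⁻¹)'| ≤ |ρ_q'| (8λ_q^α/δ_{q+1})²`** on `[0,T]`. [cite: BuckmasterEtAl2018, Prop. 5.9 (proof, arXiv (5.42))] -/
theorem CoreHypotheses.abs_invRhoQDeriv_le (H : CoreHypotheses P S Nbar Cin C₀)
    (ha : 1 ≤ P.a)
    (h4 : 4 * amp P.β P.a P.b (S.q + 2) ≤ amp P.β P.a P.b (S.q + 1) * freq P.a P.b S.q ^ (-P.α))
    {t : ℝ} (ht : t ∈ Icc 0 S.T) :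
    |(-rhoQDeriv S t / rhoQ P S t ^ 2)| ≤
      |rhoQDeriv S t| * (8 * freq P.a P.b S.q ^ P.α / amp P.β P.a P.b (S.q + 1)) ^ 2 := by
  have hρ := H.rhoQ_pos_of_four ha h4 ht
  have hinv := H.abs_inv_rhoQ_le ha h4 ht
  rw [abs_div, abs_neg, abs_of_pos (pow_pos hρ 2), div_eq_mul_inv, ← inv_pow]
  refine mul_le_mul_of_nonneg_left ?_ (abs_nonneg _)
  rw [abs_of_pos (inv_pos.2 hρ)] at hinv
  exact pow_le_pow_left₀ (inv_pos.2 hρ).le hinv 2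

end RhoQ

end DeRosa

/-! ## Port of `OnsagerBDSVTildeRTransportProofs` -/

namespace DeRosa

open BDSV

open FunctionSpaces FunctionSpaces.Torus

section Inputs

variable {P : Params} {S : Setting} {Nbar N : ℕ} {Cin C₀ : ℝ}

/-- **(2.19), graded**: `‖∇v̄_q(t)‖_{j,0} ≤ (C_in δ_q^{1/2} λ_q) ℓ^{-j}` for `j ≤ N ≤ N̄`, `t ∈ [0,T]`
(`‖∇v̄_q‖_j ≤ ‖v̄_q‖_{j+1}`). [cite: BuckmasterEtAl2018, §2.5 (2.19)] -/
theorem CoreHypotheses.gradedSupLE_gradField_vbar (H : CoreHypotheses P S Nbar Cin C₀)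
    (hN : N ≤ Nbar) :
    GradedSupLE (Icc 0 S.T) (gradField S.vbar) N
      (Cin * (Real.sqrt (amp P.β P.a P.b S.q) * freq P.a P.b S.q)) (mollScale P.β P.α P.a P.b S.q) := by
  refine gradedSupLE_fderiv_of_succ fun j hj t ht => ?_
  refine (H.velocity j (hj.trans hN) t ht).trans (le_of_eq ?_)
  congr 1
  ring

/-- **(2.20), graded, through a continuous linear map of the columns**: for `C_in ≥ 0`,
`‖L(R̊̄_q(t))‖_{j,0} ≤ ‖L‖ · 3 C_in δ_{q+1} ℓ^α · ℓ^{-j}` for `j ≤ N ≤ N̄` (`‖·‖_{j,0} ≤ 3‖·‖_{j,α}`).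
[cite: BuckmasterEtAl2018, §2.5 (2.20)] -/
theorem CoreHypotheses.gradedSupLE_clm_Rbar (H : CoreHypotheses P S Nbar Cin C₀)
    (ha : 1 ≤ P.a) (hN : N ≤ Nbar) {Z : Type*} [NormedAddCommGroup Z] [NormedSpace ℝ Z]
    (L : (Fin 3 → EuclideanSpace ℝ (Fin 3)) →L[ℝ] Z) :
    GradedSupLE (Icc 0 S.T) (fun t x => L (S.Rbar t x)) N
      (‖L‖ * (3 * (Cin * (amp P.β P.a P.b (S.q + 1) * mollScale P.β P.α P.a P.b S.q ^ P.α))))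
      (mollScale P.β P.α P.a P.b S.q) := by
  have hℓ := mollScale_pos (β := P.β) (α := P.α) (b := P.b) ha S.q
  have hR : GradedSupLE (Icc 0 S.T) S.Rbar N
      (3 * (Cin * (amp P.β P.a P.b (S.q + 1) * mollScale P.β P.α P.a P.b S.q ^ P.α)))
      (mollScale P.β P.α P.a P.b S.q) := by
    refine gradedSupLE_of_holder (r := Real.toNNReal P.α) fun j hj t ht => ?_
    refine (H.stress j (hj.trans hN) t ht).trans (le_of_eq ?_)
    congr 1
    rw [Real.rpow_add hℓ]
    ring
  exact hR.clm (fun t ht => H.eulerReynolds.smooth_stress.isSmooth_slice ht) L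

/-- **(2.21), graded, through a continuous linear map of the columns**: for `C_in ≥ 0`,
`‖L(D_{t,q}R̊̄_q(t))‖_{j,0} ≤ ‖L‖ · 3 C_in δ_{q+1} δ_q^{1/2} λ_q ℓ^{-α} · ℓ^{-j}` for `j ≤ N ≤ N̄`.
[cite: BuckmasterEtAl2018, §2.5 (2.21)] -/
theorem CoreHypotheses.gradedSupLE_clm_advectiveDeriv_Rbar
    (H : CoreHypotheses P S Nbar Cin C₀) (ha : 1 ≤ P.a) (hN : N ≤ Nbar)
    {Z : Type*} [NormedAddCommGroup Z] [NormedSpace ℝ Z]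
    (L : (Fin 3 → EuclideanSpace ℝ (Fin 3)) →L[ℝ] Z) :
    GradedSupLE (Icc 0 S.T) (fun t x => L (advectiveDeriv S.T S.vbar S.Rbar t x)) N
      (‖L‖ * (3 * (Cin * (amp P.β P.a P.b (S.q + 1) * Real.sqrt (amp P.β P.a P.b S.q) *
        freq P.a P.b S.q * mollScale P.β P.α P.a P.b S.q ^ (-P.α)))))
      (mollScale P.β P.α P.a P.b S.q) := by
  have hℓ := mollScale_pos (β := P.β) (α := P.α) (b := P.b) ha S.q
  have hR : GradedSupLE (Icc 0 S.T) (advectiveDeriv S.T S.vbar S.Rbar) N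
      (3 * (Cin * (amp P.β P.a P.b (S.q + 1) * Real.sqrt (amp P.β P.a P.b S.q) *
        freq P.a P.b S.q * mollScale P.β P.α P.a P.b S.q ^ (-P.α))))
      (mollScale P.β P.α P.a P.b S.q) := by
    refine gradedSupLE_of_holder (r := Real.toNNReal P.α) fun j hj t ht => ?_
    refine (H.transport j (hj.trans hN) t ht).trans (le_of_eq ?_)
    congr 1
    rw [sub_eq_add_neg, Real.rpow_add hℓ]
    ring
  exact hR.clm (fun t ht => isSmooth_advectiveDeriv_slice H.pos_T H.eulerReynolds.smooth_velocity
    H.eulerReynolds.smooth_stress ht) L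

end Inputs

section PiMaps

end PiMaps

section Window

variable {T : ℝ} {v : ℝ → UnitAddTorus (Fin 3) → EuclideanSpace ℝ (Fin 3)}
  {D : ℕ → ℝ → UnitAddTorus (Fin 3) → EuclideanSpace ℝ (Fin 3)} {i N : ℕ} {J : Set ℝ} {ℓ : ℝ}

end Window

section Stress

variable {T : ℝ} {v : ℝ → UnitAddTorus (Fin 3) → EuclideanSpace ℝ (Fin 3)}
  {R : ℝ → UnitAddTorus (Fin 3) → Fin 3 → EuclideanSpace ℝ (Fin 3)} {N : ℕ} {ℓ : ℝ}

end Stress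

section Conjugation

variable {T : ℝ} {v : ℝ → UnitAddTorus (Fin 3) → EuclideanSpace ℝ (Fin 3)} {N : ℕ} {ℓ : ℝ}
  {G M : ℝ → UnitAddTorus (Fin 3) → (Fin 3 → Fin 3 → ℝ)}

end Conjugation

section Params

variable {β α a b : ℝ}

end Params

section Assembly

/-- **The material-derivative bound for the conjugated stress holds** (BDSV Prop. 5.9, second
item, arXiv (5.38): for `t ∈ Ĩ_i` and `N ≥ 0`, `‖D_{t,q}R̃_{q,i}‖_N ≲ τ_q^{-1}ℓ^{-N}`). Proof as
printed (§5.5): Leibniz expansion of `D_{t,q}(∇Φ_i M ∇Φ_iᵀ)`, `M = R_{q,i}/ρ_{q,i} = Id - ρ_q⁻¹R̊̄_q`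
(mass `∑∫η_j² = 1` on `supp R̊̄_q`), with `D_{t,q}∇Φ_i = -∇Φ_iDv̄_q` bounded through (2.19) and the
all-orders flow bound (5.23) on the window around `Ĩ_i` (smallness `τ_qδ_q^{1/2}λ_q = ℓ^{2α} → 0`),
`D_{t,q}M` through (2.20), (2.21), `ρ_q ≥ δ_{q+1}λ_q^{-α}/8` (5.15) and `|ρ_q'| ≲ 1 + δ_{q+1}δ_q^{1/2}λ_q`
(5.18), and the parameter inequalities `δ_q^{1/2}λ_q ≤ τ_q⁻¹ = δ_q^{1/2}λ_qℓ^{-2α}`, `λ_q^αℓ^α ≤ 1`,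
`λ_q^α ≤ ℓ^{-α}`, `δ_{q+1}⁻¹ ≤ δ_q^{1/2}λ_q` (`a` large, `b < (1-β)/(2β)`). The threshold `α₀` is
`2βb(b-1)` (for (5.15)), `N̄ = N`, and the constant depends on `N` and `C_in` only.
[cite: BuckmasterEtAl2018, Prop. 5.9 (arXiv (5.38))] -/
theorem tildeRTransportBound_holds : tildeRTransportBound := by
  intro c₀ _hc₀ Cη β hβ _hβ3 b hb1 hb2
  -- `α₀ = 2βb(b-1)` (for the lower bound (5.15) on `ρ_q`)
  have hb0 : 0 < b := by linarith
  have hb1' : 0 < b - 1 := by linarith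
  refine ⟨2 * β * b * (b - 1), mul_pos (mul_pos (mul_pos two_pos hβ) hb0) hb1', ?_⟩
  intro α hα hαb N
  -- the continuous (bi)linear maps of the matrix plumbing
  obtain ⟨Bm, hBm⟩ := exists_matrixMulCLM_pi
  obtain ⟨Lt, hLt⟩ := exists_transposeCLM_pi
  obtain ⟨Loc, hLoc⟩ := exists_ofColsCLM_pi
  obtain ⟨Lj, hLj⟩ := exists_jacCLM_pi
  -- the identity matrix on the coordinate carrier
  set E₀ : Fin 3 → Fin 3 → ℝ := (1 : Matrix (Fin 3) (Fin 3) ℝ) with hE₀def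
  -- the flow constant
  obtain ⟨K, hK2, hK⟩ := displacement_allOrders (d := Fin 3) N
  refine ⟨N, ?_⟩
  intro Cin C₀
  -- thresholds
  obtain ⟨a₁, ha₁1, ha₁⟩ :=
    exists_threshold_mollScale_rpow_le hβ.le hb1.le hα (5 / 3 * K * |Cin|) one_pos
  obtain ⟨a₂, ha₂1, ha₂⟩ := exists_threshold_four_amp (β := β) hb1 hαb
  obtain ⟨a₃, ha₃1, ha₃⟩ := exists_threshold_amp_succ_inv_le hβ hb1 hb2
  -- constants: `Cp = |C_in|`, the Leibniz factor `Pm`, and `c₁, c₂, c₃` (opaque names)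
  set Cp : ℝ := |Cin| with hCpdef
  have hCp : 0 ≤ Cp := abs_nonneg Cin
  obtain ⟨cL, hcL⟩ : ∃ cL : ℝ, cL = ‖ContinuousLinearMap.compL ℝ (EuclideanSpace ℝ (Fin 3))
      (EuclideanSpace ℝ (Fin 3)) (EuclideanSpace ℝ (Fin 3))‖ := ⟨_, rfl⟩
  have hcL0 : 0 ≤ cL := by rw [hcL]; positivity
  obtain ⟨c₁, hc₁⟩ : ∃ c₁ : ℝ, c₁ = ‖Lj‖ * (Cp + 3 ^ N * (N + 1) * cL * 1 * Cp) := ⟨_, rfl⟩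
  have hc₁0 : 0 ≤ c₁ := by
    rw [hc₁]
    exact mul_nonneg (norm_nonneg Lj) (add_nonneg hCp
      (mul_nonneg (mul_nonneg (mul_nonneg (by positivity) hcL0) zero_le_one) hCp))
  obtain ⟨c₂, hc₂⟩ : ∃ c₂ : ℝ, c₂ = ‖E₀‖ + 24 * ‖Loc‖ * Cp := ⟨_, rfl⟩
  have hc₂0 : 0 ≤ c₂ := by
    rw [hc₂]
    exact add_nonneg (norm_nonneg _) (mul_nonneg (mul_nonneg (by norm_num) (norm_nonneg _)) hCp)
  obtain ⟨c₃, hc₃⟩ : ∃ c₃ : ℝ, c₃ = (88 * Cp + 384 * Cp ^ 3) * ‖Loc‖ := ⟨_, rfl⟩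
  have hc₃0 : 0 ≤ c₃ := by
    rw [hc₃]
    exact mul_nonneg (add_nonneg (mul_nonneg (by norm_num) hCp)
      (mul_nonneg (by norm_num) (pow_nonneg hCp 3))) (norm_nonneg _)
  have hPm : 0 ≤ (3 : ℝ) ^ N * (N + 1) * ‖Bm‖ := by positivity
  refine ⟨3 ^ N * (N + 1) * ‖Bm‖ * (3 ^ N * (N + 1) * ‖Bm‖ * c₁ * c₂) * (‖Lt‖ * 18) +
      3 ^ N * (N + 1) * ‖Bm‖ * (3 ^ N * (N + 1) * ‖Bm‖ * 18 * c₃) * (‖Lt‖ * 18) +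
      3 ^ N * (N + 1) * ‖Bm‖ * (3 ^ N * (N + 1) * ‖Bm‖ * 18 * c₂) * (‖Lt‖ * c₁),
    max a₁ (max a₂ a₃), lt_max_of_lt_left ha₁1, ?_⟩
  intro a ha S H 𝒟 i
  -- parameters
  have haa₁ : a₁ ≤ a := (le_max_left _ _).trans ha
  have haa₂ : a₂ ≤ a := ((le_max_left _ _).trans (le_max_right _ _)).trans ha
  have haa₃ : a₃ ≤ a := ((le_max_right _ _).trans (le_max_right _ _)).trans ha
  have ha1 : 1 ≤ a := ha₁1.le.trans haa₁
  have hK0 : 0 ≤ K := zero_le_two.trans hK2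
  set ℓ := mollScale β α a b S.q with hℓdef
  set τ := Params.τ ⟨β, α, a, b⟩ S.q with hτdef
  have hℓ : 0 < ℓ := mollScale_pos ha1 _
  have hℓ1 : ℓ ≤ 1 := mollScale_le_one_of_params ha1 hb1.le hβ.le hα.le S.q
  have hτ : 0 < τ := glueScale_pos ha1 _
  have hT : 0 < S.T := H.pos_T
  have hf := freq_pos (b := b) ha1 S.q
  have hδ₁ := amp_pos (β := β) (b := b) ha1 (S.q + 1)
  set W : ℝ := Real.sqrt (amp β a b S.q) * freq a b S.q with hWdef
  have hW0 : 0 ≤ W := mul_nonneg (Real.sqrt_nonneg _) hf.le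
  obtain ⟨X, hX⟩ : ∃ X : ℝ, X = (ℓ ^ α)⁻¹ ^ 2 := ⟨_, rfl⟩
  -- the standing hypotheses with the nonnegative constant `Cp = |C_in|`
  have H' : CoreHypotheses ⟨β, α, a, b⟩ S N Cp C₀ := H.mono_const ha1 (le_abs_self Cin)
  have hvsm : Torus.IsSmoothSpaceTimeOn (Icc 0 S.T) S.vbar := H.eulerReynolds.smooth_velocity
  have hRsm : Torus.IsSmoothSpaceTimeOn (Icc 0 S.T) S.Rbar := H.eulerReynolds.smooth_stress
  have hDsm : Torus.IsSmoothSpaceTimeOn (Icc 0 S.T) (𝒟.D i) := (𝒟.flow i).smooth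
  -- thresholds at this `a`
  have hsmall0 : 5 / 3 * K * |Cin| * ℓ ^ (2 * α) ≤ 1 := ha₁ a haa₁ S.q
  have h4 : 4 * amp β a b (S.q + 2) ≤ amp β a b (S.q + 1) * freq a b S.q ^ (-α) := ha₂ a haa₂ S.q
  have hδW : (amp β a b (S.q + 1))⁻¹ ≤ W := ha₃ a haa₃ S.q
  -- parameter inequalities
  have hLE : freq a b S.q ^ α * ℓ ^ α ≤ 1 :=
    freq_rpow_mul_mollScale_rpow_le_one' ha1 hb1.le hβ.le hα.le S.q
  have hLE' : freq a b S.q ^ α ≤ (ℓ ^ α)⁻¹ := by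
    rw [← Real.rpow_neg hℓ.le]
    exact freq_rpow_le_mollScale_rpow_neg ha1 hb1.le hβ.le hα.le S.q
  have hEpos : 0 < ℓ ^ α := Real.rpow_pos_of_pos hℓ _
  have hE1 : ℓ ^ α ≤ 1 := Real.rpow_le_one hℓ.le hℓ1 hα.le
  have hEi1 : 1 ≤ (ℓ ^ α)⁻¹ := (one_le_inv₀ hEpos).2 hE1
  have hX1 : 1 ≤ X := by rw [hX]; nlinarith
  have hX2 : (ℓ ^ α)⁻¹ ^ 2 = ℓ ^ (-(2 * α)) := by
    rw [← Real.rpow_neg hℓ.le, ← Real.rpow_natCast, ← Real.rpow_mul hℓ.le]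
    congr 1
    push_cast
    ring
  have hτinv : τ⁻¹ = W * X := by
    rw [hX, hX2, hWdef]
    change (glueScale β α a b S.q)⁻¹ = _
    rw [glueScale_inv_eq ha1]
  -- ### the graded inputs on `[0,T]`
  have hvg : GradedSupLE (Icc 0 S.T) (gradField S.vbar) N (Cp * W) ℓ :=
    H'.gradedSupLE_gradField_vbar le_rfl
  have hRb : GradedSupLE (Icc 0 S.T) (fun t x => Loc (S.Rbar t x)) N
      (‖Loc‖ * (3 * (Cp * (amp β a b (S.q + 1) * ℓ ^ α)))) ℓ :=
    H'.gradedSupLE_clm_Rbar ha1 le_rfl Loc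
  have hDRb : GradedSupLE (Icc 0 S.T) (fun t x => Loc (advectiveDeriv S.T S.vbar S.Rbar t x)) N
      (‖Loc‖ * (3 * (Cp * (amp β a b (S.q + 1) * W * (ℓ ^ α)⁻¹)))) ℓ := by
    have h := H'.gradedSupLE_clm_advectiveDeriv_Rbar ha1 le_rfl Loc
    refine h.mono hℓ (le_of_eq ?_)
    change ‖Loc‖ * (3 * (Cp * (amp β a b (S.q + 1) * Real.sqrt (amp β a b S.q) * freq a b S.q *
      ℓ ^ (-α)))) = _
    rw [Real.rpow_neg hℓ.le, hWdef]
    ring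
  -- ### `ρ_q⁻¹`
  set θ : ℝ → ℝ := fun t => (rhoQ ⟨β, α, a, b⟩ S t)⁻¹ with hθdef
  set θ' : ℝ → ℝ := fun t => -rhoQDeriv S t / rhoQ ⟨β, α, a, b⟩ S t ^ 2 with hθ'def
  have hθc : ContDiffOn ℝ ∞ θ (Icc 0 S.T) := H'.contDiffOn_inv_rhoQ ha1 h4
  have hθd : ∀ t ∈ Icc 0 S.T, HasDerivWithinAt θ (θ' t) (Icc 0 S.T) t := fun t ht =>
    H'.hasDerivWithinAt_inv_rhoQ ha1 h4 ht
  set m : ℝ := 8 * freq a b S.q ^ α / amp β a b (S.q + 1) with hmdef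
  have hm0 : 0 ≤ m := div_nonneg (mul_nonneg (by norm_num) (Real.rpow_nonneg hf.le _)) hδ₁.le
  have hm : ∀ t ∈ Icc 0 S.T, |θ t| ≤ m := fun t ht => H'.abs_inv_rhoQ_le ha1 h4 ht
  set ρmax : ℝ := (1 + 6 * (Cp * (amp β a b (S.q + 1) * ℓ ^ α)) * (Cp * W)) / 3 with hρmaxdef
  have hρmax0 : 0 ≤ ρmax :=
    div_nonneg (add_nonneg zero_le_one (mul_nonneg (mul_nonneg (by norm_num)
      (mul_nonneg hCp (mul_nonneg hδ₁.le hEpos.le))) (mul_nonneg hCp hW0))) zero_le_three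
  set m' : ℝ := ρmax * m ^ 2 with hm'def
  have hm'0 : 0 ≤ m' := mul_nonneg hρmax0 (sq_nonneg _)
  have hm' : ∀ t ∈ Icc 0 S.T, |θ' t| ≤ m' := by
    intro t ht
    have h1 := H'.abs_invRhoQDeriv_le ha1 h4 ht
    have h2 := H'.abs_rhoQDeriv_le hCp ha1 ht
    exact h1.trans (mul_le_mul_of_nonneg_right h2 (sq_nonneg _))
  -- ### `M` and `D_t M` on `[0,T]`
  have hAR0 : 0 ≤ ‖Loc‖ * (3 * (Cp * (amp β a b (S.q + 1) * ℓ ^ α))) :=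
    mul_nonneg (norm_nonneg _) (mul_nonneg zero_le_three (mul_nonneg hCp (mul_nonneg hδ₁.le hEpos.le)))
  have hAD0 : 0 ≤ ‖Loc‖ * (3 * (Cp * (amp β a b (S.q + 1) * W * (ℓ ^ α)⁻¹))) :=
    mul_nonneg (norm_nonneg _) (mul_nonneg zero_le_three (mul_nonneg hCp
      (mul_nonneg (mul_nonneg hδ₁.le hW0) (zero_le_one.trans hEi1))))
  have hMb : GradedSupLE (Icc 0 S.T) (fun t x => E₀ - θ t • Loc (S.Rbar t x)) N c₂ ℓ := by
    have h := gradedSupLE_normStress E₀ hℓ hℓ1 (fun t ht => hRsm.isSmooth_slice ht) hRb hAR0 hm hm0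
    refine h.mono hℓ ?_
    rw [hc₂]
    refine add_le_add le_rfl ?_
    -- `m · ‖Loc‖ 3 Cp δ ℓ^α = 24 ‖Loc‖ Cp (λ^α ℓ^α) ≤ 24 ‖Loc‖ Cp`
    have e : m * (‖Loc‖ * (3 * (Cp * (amp β a b (S.q + 1) * ℓ ^ α)))) =
        24 * ‖Loc‖ * Cp * (freq a b S.q ^ α * ℓ ^ α) := by
      rw [hmdef]
      field_simp
      ring
    rw [e]
    exact mul_le_of_le_one_right (mul_nonneg (mul_nonneg (by norm_num) (norm_nonneg _)) hCp) hLE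
  have hdMb : GradedSupLE (Icc 0 S.T)
      (advectiveDeriv S.T S.vbar (fun t x => E₀ - θ t • Loc (S.Rbar t x))) N (c₃ * (W * X)) ℓ := by
    have h := gradedSupLE_advectiveDeriv_normStress hT E₀ hθc hθd Loc hvsm hRsm hℓ hRb hAR0
      hDRb hAD0 hm hm0 hm' hm'0
    refine h.mono hℓ ?_
    have key := normStressDeriv_amplitude_le (L := freq a b S.q ^ α) (E := ℓ ^ α)
      (δ := amp β a b (S.q + 1)) (W := W) (C := Cp) (c := ‖Loc‖)
      (Real.rpow_nonneg hf.le _) hEpos hE1 hLE hLE' hδ₁ hδW hCp (norm_nonneg _)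
    rw [hc₃, hX]
    exact key
  -- ### the bound on `Ĩ_i`: through the window around it
  have key : ∀ t ∈ tildeInterval S.T τ i,
      Torus.eContDiffHolderNorm N 0
          (advectiveDeriv S.T S.vbar (tildeR ⟨β, α, a, b⟩ S 𝒟.cut.η 𝒟.D i) t) ≤
        ENNReal.ofReal ((3 ^ N * (N + 1) * ‖Bm‖ * (3 ^ N * (N + 1) * ‖Bm‖ * c₁ * c₂) * (‖Lt‖ * 18) +
          3 ^ N * (N + 1) * ‖Bm‖ * (3 ^ N * (N + 1) * ‖Bm‖ * 18 * c₃) * (‖Lt‖ * 18) +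
          3 ^ N * (N + 1) * ‖Bm‖ * (3 ^ N * (N + 1) * ‖Bm‖ * 18 * c₂) * (‖Lt‖ * c₁)) *
            (τ⁻¹ * ℓ ^ (-(N : ℝ)))) := by
    intro t ht
    obtain ⟨hab', hsub, ht₀, hlen, hIsub⟩ := tildeInterval_window hT hτ i ht
    have ht' := hIsub ht
    -- the displacement bound on the window
    set Λ : ℝ := Cp * W with hΛdef
    have hΛ0 : 0 ≤ Λ := mul_nonneg hCp hW0
    set Mℓ : ℝ := ℓ⁻¹ with hMℓdef
    have hMℓ1 : 1 ≤ Mℓ := (one_le_inv₀ hℓ).2 hℓ1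
    have hMℓpow : ∀ n : ℕ, ℓ ^ (-(n : ℝ)) = Mℓ ^ n := fun n => by
      rw [Real.rpow_neg hℓ.le, Real.rpow_natCast, hMℓdef, inv_pow]
    have hΛτ : Λ * τ = Cp * ℓ ^ (2 * α) :=
      velocityBound_mul_tau (P := ⟨β, α, a, b⟩) (Cin := Cp) ha1 S.q
    have hvb : ∀ s ∈ Icc 0 S.T, ∀ j ≤ N,
        Torus.eContDiffHolderNorm (j + 1) 0 (S.vbar s) ≤ ENNReal.ofReal (Λ * Mℓ ^ j) := by
      intro s hs j hj
      refine (H'.velocity j hj s hs).trans (le_of_eq ?_)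
      change ENNReal.ofReal (Cp * (Real.sqrt (amp β a b S.q) * freq a b S.q * ℓ ^ (-(j : ℝ)))) = _
      rw [hMℓpow j, hΛdef, hWdef]
      ring_nf
    have heq0 : ∀ s ∈ Icc 0 S.T, ∀ x, Torus.timeDerivWithin (Icc 0 S.T) (𝒟.D i) s x +
        Torus.convect (S.vbar s) (𝒟.D i s) x = -S.vbar s x :=
      fun s hs x => eq_neg_of_add_eq_zero_left ((𝒟.flow i).transport s hs x)
    have hsmall : (min S.T (((i : ℝ) + 1) * τ + τ / 3) - max 0 ((i : ℝ) * τ - τ / 3)) * Λ * K ≤ 1 := by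
      calc (min S.T (((i : ℝ) + 1) * τ + τ / 3) - max 0 ((i : ℝ) * τ - τ / 3)) * Λ * K
          ≤ (5 / 3 * τ) * Λ * K := mul_le_mul_of_nonneg_right (mul_le_mul_of_nonneg_right hlen hΛ0) hK0
        _ = 5 / 3 * K * (Λ * τ) := by ring
        _ = 5 / 3 * K * |Cin| * ℓ ^ (2 * α) := by rw [hΛτ, hCpdef]; ring
        _ ≤ 1 := hsmall0
    have hKLΛ : K * ((min S.T (((i : ℝ) + 1) * τ + τ / 3) - max 0 ((i : ℝ) * τ - τ / 3)) * Λ) ≤ 1 := by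
      calc K * ((min S.T (((i : ℝ) + 1) * τ + τ / 3) - max 0 ((i : ℝ) * τ - τ / 3)) * Λ)
          = (min S.T (((i : ℝ) + 1) * τ + τ / 3) - max 0 ((i : ℝ) * τ - τ / 3)) * Λ * K := by ring
        _ ≤ 1 := hsmall
    have heq' := transport_restrict hab' hsub hDsm heq0
    have hDb : ∀ s ∈ Icc (max 0 ((i : ℝ) * τ - τ / 3)) (min S.T (((i : ℝ) + 1) * τ + τ / 3)), ∀ n ≤ N,
        Torus.eContDiffHolderNorm (n + 1) 0 (𝒟.D i s) ≤ ENNReal.ofReal (ℓ ^ (-(n : ℝ))) := by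
      intro s hs n hn
      have h := hK hab' (hvsm.mono hsub) (hDsm.mono hsub) heq' ht₀ (𝒟.flow i).anchor hΛ0 hMℓ1
        (fun s hs j hj => hvb s (hsub hs) j hj) hsmall s hs n hn
      refine h.trans (ENNReal.ofReal_le_ofReal ?_)
      rw [hMℓpow n]
      calc K * ((min S.T (((i : ℝ) + 1) * τ + τ / 3) - max 0 ((i : ℝ) * τ - τ / 3)) * Λ) * Mℓ ^ n
          ≤ 1 * Mℓ ^ n := mul_le_mul_of_nonneg_right hKLΛ (zero_le_one.trans (one_le_pow₀ hMℓ1))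
        _ = Mℓ ^ n := one_mul _
    -- graded bounds for `∇Φ_i`, `∇D_i`, `D_t ∇Φ_i` on the window
    have hDs : ∀ s ∈ Icc (max 0 ((i : ℝ) * τ - τ / 3)) (min S.T (((i : ℝ) + 1) * τ + τ / 3)),
        IsSmooth (𝒟.D i s) := fun s hs => hDsm.isSmooth_slice (hsub hs)
    have hGb := gradedSupLE_gradPhi_of_disp hℓ hℓ1 hDs hDb
    have hDg := gradedSupLE_gradField_of_disp hDb
    have htr : ∀ s ∈ Icc 0 S.T, ∀ x, advectiveDeriv S.T S.vbar (𝒟.D i) s x = -S.vbar s x :=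
      fun s hs x => (𝒟.flow i).advectiveDeriv_eq hs x
    have hdGb : GradedSupLE (Icc (max 0 ((i : ℝ) * τ - τ / 3)) (min S.T (((i : ℝ) + 1) * τ + τ / 3)))
        (advectiveDeriv S.T S.vbar (fun s y => gradPhi 𝒟.D i s y)) N (c₁ * W) ℓ := by
      have h := gradedSupLE_advectiveDeriv_gradPhi hT hLj hvsm hDsm htr hsub hℓ hΛ0
        (hvg.anti hsub) hDg
      refine h.mono hℓ (le_of_eq ?_)
      rw [hc₁, hcL, hΛdef]
      ring
    -- graded bounds for `M`, `D_t M` on the window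
    have hMw := hMb.anti hsub
    have hdMw := hdMb.anti hsub
    -- the conjugated stress `G M Gᵀ` on the window
    have hGsm : Torus.IsSmoothSpaceTimeOn (Icc 0 S.T) (fun s y => (gradPhi 𝒟.D i s y : Fin 3 → Fin 3 → ℝ)) :=
      contDiffOn_pi' fun k => contDiffOn_pi' fun l =>
        isSmoothSpaceTimeOn_gradPhi hT (fun j => (𝒟.flow j).smooth) i k l
    have hMsm : Torus.IsSmoothSpaceTimeOn (Icc 0 S.T) (fun s y => E₀ - θ s • Loc (S.Rbar s y)) :=
      (Torus.isSmoothSpaceTimeOn_const (isSmooth_const _) _).sub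
        ((isSmoothSpaceTimeOn_of_time hθc).smul (hRsm.clm_comp Loc))
    have hconj := gradedSupLE_advectiveDeriv_conj hT Bm Lt hvsm hGsm hMsm hsub hℓ (by norm_num)
      (mul_nonneg hc₁0 hW0) hc₂0 (mul_nonneg hc₃0 (mul_nonneg hW0 (zero_le_one.trans hX1)))
      hGb hdGb hMw hdMw
    -- `R̃_{q,i} = G M Gᵀ` on `[0,T]`
    have hRt : ∀ s ∈ Icc 0 S.T, ∀ y, tildeR ⟨β, α, a, b⟩ S 𝒟.cut.η 𝒟.D i s y =
        Bm (Bm (gradPhi 𝒟.D i s y) (E₀ - θ s • Loc (S.Rbar s y))) (Lt (gradPhi 𝒟.D i s y)) := by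
      intro s hs y
      rw [hBm, hBm, hLt, hLoc, 𝒟.tildeR_eq H ha1 i hs y]
      rfl
    have hfinal := (hconj.congr fun s hs y =>
      (advectiveDeriv_congr (T := S.T) (v := S.vbar) hRt (hsub hs) y).symm).le ht' le_rfl
    refine hfinal.trans (ENNReal.ofReal_le_ofReal ?_)
    -- the amplitude is at most `C τ⁻¹`
    rw [hτinv]
    have hmain := conjDeriv_amplitude_le hPm (norm_nonneg Lt) hc₁0 hc₂0 hc₃0 hW0 hX1
    refine le_trans (mul_le_mul_of_nonneg_right hmain (Real.rpow_nonneg hℓ.le _)) (le_of_eq ?_)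
    ring
  exact fun t ht => key t ht

end Assembly

end DeRosa

end Literature.Analysis.FluidPDE
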